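import Summits.HubbardSuperconductivity.HubbardLadder.ClusterCutBlocks
import HarnessLib

/-!
# Cluster pair-cuts: the integer pair list of cut adv33_it7_s6 (`cut_oct12_adv33oct12it7.json` 97e8cec4521560cc, σ_road = −54759/250000 = the file's certified σ rounded down to 10⁻⁶)

HONEST FRAMING: ladder R1–R4 with certified numbers; no claim on H/H₀.  Cell pub-hubbard, lane r2-eng-1 (g14; g13 generators `adv06cert-g13/gen/`).  Kernel-side data of the cut
(`DEN = 10⁶`): the integer pair list `adv33it7P` (one orientation `(i, j, DEN·a_o)` per pair of orbit `o`, sites in the order of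
`Oct12Representation`) and `pairsOK 12 adv33it7P` (kernel).  The per-piece kernel certificates `ClusterCutOct12Adv33It7FrameNN` are stated for
`pairOp adv33it7P`; the identity with the cut's symmetric weight table (`= 2 • pairOp adv33it7P`) belongs with the row assembly.  All statements [folklore].
-/

namespace Summit.HubbardSuperconductivity.HubbardLadder.ClusterCut

open Matrix Literature.MathematicalPhysics.QuantumLattice

/-- The integer pair list of cut adv33_it7_s6: one orientation `(i, j, DEN·a_o)` per pair of orbit `o` (`DEN = 10⁶`; 66 pairs). -/
def adv33it7P : NatPairList :=
  [(0, 1, -1550), (0, 2, 11349), (0, 3, 46693), (0, 4, -594), (0, 5, -3244), (0, 6, -3244),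
   (0, 7, 8783), (0, 8, -9705), (0, 9, -2293), (0, 10, -3075), (0, 11, -290), (1, 2, -3244),
   (1, 3, -594), (1, 4, 46693), (1, 5, 11349), (1, 6, -2293), (1, 7, -9705), (1, 8, 8783),
   (1, 9, -3244), (1, 10, -290), (1, 11, -3075), (2, 3, 46693), (2, 4, 8783), (2, 5, -3075),
   (2, 6, -1550), (2, 7, -594), (2, 8, -9705), (2, 9, -290), (2, 10, -3244), (2, 11, -2293),
   (3, 4, 90223), (3, 5, 8783), (3, 6, -594), (3, 7, 90223), (3, 8, -6365), (3, 9, -9705),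
   (3, 10, 8783), (3, 11, -9705), (4, 5, 46693), (4, 6, -9705), (4, 7, -6365), (4, 8, 90223),
   (4, 9, -594), (4, 10, -9705), (4, 11, 8783), (5, 6, -290), (5, 7, -9705), (5, 8, -594),
   (5, 9, -1550), (5, 10, -2293), (5, 11, -3244), (6, 7, 46693), (6, 8, 8783), (6, 9, -3075),
   (6, 10, 11349), (6, 11, -3244), (7, 8, 90223), (7, 9, 8783), (7, 10, 46693), (7, 11, -594),
   (8, 9, 46693), (8, 10, -594), (8, 11, 46693), (9, 10, -3244), (9, 11, 11349), (10, 11, -1550)]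

/-- Kernel: in every pair of `adv33it7P` the sites are `< 12` and distinct. -/
theorem adv33it7P_ok : pairsOK 12 adv33it7P = true := by decide

end Summit.HubbardSuperconductivity.HubbardLadder.ClusterCut
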